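import Literature.NumberTheory.EllipticCurves.ThreeIsogeny
import Literature.NumberTheory.EllipticCurves.KummerMap
import Mathlib.Topology.LocallyConstant.Basic
import HarnessLib

/-!
# The `μ₃`-Kummer classes of the Mordell curves `y² = x³ − 3c²` in `H¹(K, E)` (first `3`-descent
# by the `3`-isogeny with kernel `μ₃`)

Topic `NumberTheory/EllipticCurves`. Library half (no barrier imports) of the programme recorded in
`Literature/Barriers/BirchSwinnertonDyer/DescentDefectUnboundedCasselsProofs.lean` towards the
named fact `Literature.Barriers.BirchSwinnertonDyer.Cassels1964_sha_threeRank_jZero` (Cassels 1964,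
*Arithmetic on curves of genus 1, VI*: `Ш(C_d/ℚ)[3]` is unbounded for `C_d : x³ + y³ + d z³ = 0`).
Cassels' curve `C_d` is the Mordell curve `y² = x³ − 432 d² = x³ − 3 (12 d)²` and his torsors
(2) `m x³ + m⁻¹ y³ + d z³ = 0`, `m ∈ ℚ*`, are the images of `m ∈ ℚ*/ℚ*³ = H¹(ℚ, μ₃)` in
`H¹(ℚ, C_d)` under the `3`-isogeny `φ : C_d → C'_d` whose kernel `{O, (0, ±12 d √−3)}` is `μ₃` as a
Galois module (p. 65: "we get a mapping of the multiplicative group `ℚ*` … into the group `WC` of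
classes of homogeneous spaces"). This file constructs that mapping **genuinely**, in the tree's
continuous Galois cohomology `WeierstrassCurve.galH1 W = H¹_cont(Γ_K, E(K̄))` (file `Sha`), for the
Mordell curves `E = E_D : y² = x³ + D` with `D = −3c²` over any field `K` of characteristic `0`:

* `mordellCurve D = [0, 0, 0, 0, D]` (`y² = x³ + D`; `Δ = −432 D²`, `c₄ = 0`, so `j = 0`).
* `MordellDescent.theta K = √−3 ∈ K̄`, `MordellDescent.omega K = (√−3 − 1)/2`, a primitive cube
  root of unity (`isPrimitiveRoot_omega`); `Γ_K` moves `√−3` to `±√−3` and `ω` to `ω^{±1}`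
  (`galAut_theta`, `galAut_omega`), the sign being recorded as `MordellDescent.eps σ ∈ {±1} ⊂ ℤ/3ℤ`
  (the cyclotomic character mod `3`).
* `MordellDescent.torsT hc hD ∈ E(K̄)`: the kernel point `T = (0, c√−3)` of `φ`, of order `3`
  (`torsT_add_torsT`, from the tree's Vélu pair `IsVeluThreePair 0 (c√−3)` of file `ThreeIsogeny`,
  `isVeluThreePair_mordell`), with `σ • T = eps(σ) T` (`smul_torsT`): **`E[φ] ≅ μ₃`**.
* `MordellDescent.cubeRoot a = ∛a ∈ K̄` and the exponent `MordellDescent.kummerExp a σ ∈ ℤ/3ℤ` with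
  `σ(∛a) = ω^{kummerExp a σ} ∛a` (`galAut_cubeRoot`) — the Kummer cocycle of `a ∈ K*` with values in
  `μ₃`, written additively: `kummerExp a (στ) = kummerExp a σ + eps σ · kummerExp a τ`
  (`kummerExp_mul`).
* **The cocycle** `MordellDescent.torsorCocycle hc hD ha : σ ↦ (kummerExp a σ) · T`, a continuous
  crossed homomorphism `Γ_K → E(K̄)` (`f(στ) = f(σ) + σ f(τ)` precisely because `E[φ] ≅ μ₃`:
  both `T` and `ω` are multiplied by `eps σ`), and **its class**
  `MordellDescent.torsorClass hc hD ha ∈ H¹(K, E)` — the image of `a` under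
  `K*/K*³ = H¹(K, μ₃) = H¹(K, E[φ]) → H¹(K, E)`; for `K = ℚ`, `D = −432 d²` (`c = 12 d`) and
  `a = m` this is the class of Cassels' torsor (2) `m x³ + m⁻¹ y³ + d z³ = 0`.
* `3 · torsorClass = 0` (`three_nsmul_torsorClass`); the class does not depend on the chosen cube
  root and **is multiplicative in `a`** (`torsorClass_mul`: the cocycles of `ab`, `a`, `b` differ by
  the coboundary of a multiple of `T`), and vanishes on cubes (`torsorClass_of_eq_cube`); whence the
  homomorphism `MordellDescent.torsorClassHom hc hD : Kˣ →* Multiplicative H¹(K, E)` killing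
  `Kˣ³`.

What is NOT here (next steps of the programme, see the barrier `Proofs` file): the kernel of the
map (classes dying in `H¹(K, E)` come from `E'(K)` through the `φ`-descent map `(X, Y) ↦ Y − 9c` on
`E' : Y² = X³ + 81c²`), the local conditions (membership in `WeierstrassCurve.localRestrictionKer`),
and everything global.

## References

* [Cassels1964ArithmeticVI] J. W. S. Cassels, *Arithmetic on curves of genus 1. VI. The
  Tate–Šafarevič group can be arbitrarily large*, J. reine angew. Math. 214/215 (1964) 65–70,
  p. 65 (the curves (2), (4) and the map `ℚ* → WC`).
* [SilvermanAEC2009] J. H. Silverman, *The Arithmetic of Elliptic Curves*, 2nd ed., GTM 106: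
  VIII.§2 (the Kummer pairing and the connecting homomorphism `E'(K) → H¹(K, E[φ])`), X.§3
  (the Weil–Châtelet group `WC(E/K) ≅ H¹(K, E)`, Thm. X.3.6), X.§4 (Example X.4.8 and
  Prop. X.4.9: descent via an isogeny of degree `2` with `K`-rational kernel — the quadratic
  analogue of the present `μ₃`-kernel case).
* Template in the tree: `Literature.NumberTheory.EllipticCurves.KramerDescentShaGProofs` (the
  quadratic cocycles `σ ↦ χ_d(σ) T` of Kramer's `2`-isogeny descent, `B_g ≅ ℤ/2`).

## Design

* Group-wide rules of `Sha`/`GaloisAction`: `noncomputable section`, `open scoped Classical`, one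
  universe `u` with `K : Type u`; the Galois automorphism underlying `σ : Field.absoluteGaloisGroup K`
  is `MordellDescent.galAut σ : K̄ ≃ₐ[K] K̄` (the group is Mathlib's `K̄ ≃ₐ[K] K̄` by definition).
* The curve is `mordellCurve D` with a separate parameter `c` and the hypothesis `hD : D = -3 * c ^ 2`
  (so that `casselsCurve d = mordellCurve (-(432 d²))` is definitional on the barrier side, with
  `c = 12 d`).
* Exponents live in `ZMod 3`; the values `n · T` are taken through the additive map
  `MordellDescent.chiT : ZMod 3 →+ E(K̄)`, `1 ↦ T` (`ZMod.lift`, as `3T = 0`).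
-/

noncomputable section

open scoped Classical

open WeierstrassCurve

universe u

namespace Literature.NumberTheory.EllipticCurves

/-! ## The Mordell curves `y² = x³ + D` -/

section Model

variable {R : Type*} [CommRing R]

/-- **The Mordell curve `E_D : y² = x³ + D`**, `[a₁, a₂, a₃, a₄, a₆] = [0, 0, 0, 0, D]`, over any
commutative ring (the curves of `j`-invariant `0`; Cassels' `C_d : x³ + y³ + d z³ = 0` is
`E_{−432 d²}`). [folklore] -/
def mordellCurve (D : R) : WeierstrassCurve R :=
  ⟨0, 0, 0, 0, D⟩

/-- `a₁(E_D) = 0`. [folklore] -/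
@[simp] theorem mordellCurve_a₁ (D : R) : (mordellCurve D).a₁ = 0 := rfl
/-- `a₂(E_D) = 0`. [folklore] -/
@[simp] theorem mordellCurve_a₂ (D : R) : (mordellCurve D).a₂ = 0 := rfl
/-- `a₃(E_D) = 0`. [folklore] -/
@[simp] theorem mordellCurve_a₃ (D : R) : (mordellCurve D).a₃ = 0 := rfl
/-- `a₄(E_D) = 0`. [folklore] -/
@[simp] theorem mordellCurve_a₄ (D : R) : (mordellCurve D).a₄ = 0 := rfl
/-- `a₆(E_D) = D`. [folklore] -/
@[simp] theorem mordellCurve_a₆ (D : R) : (mordellCurve D).a₆ = D := rfl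

/-- `mordellCurve` is compatible with ring homomorphisms. [folklore] -/
theorem map_mordellCurve {S : Type*} [CommRing S] (f : R →+* S) (D : R) :
    (mordellCurve D).map f = mordellCurve (f D) := by
  simp [mordellCurve, WeierstrassCurve.map]

/-- Base change of `E_D` to an `R`-algebra. [folklore] -/
theorem mordellCurve_baseChange (D : R) (A : Type*) [CommRing A] [Algebra R A] :
    (mordellCurve D).baseChange A = mordellCurve (algebraMap R A D) :=
  map_mordellCurve _ D

/-- `Δ(E_D) = −432 D² = −2⁴ 3³ D²`. [folklore] -/
theorem mordellCurve_Δ (D : R) : (mordellCurve D).Δ = -(432 * D ^ 2) := by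
  simp only [mordellCurve, Δ, b₂, b₄, b₆, b₈]; ring

/-- `c₄(E_D) = 0` (`j = 0`). [folklore] -/
theorem mordellCurve_c₄ (D : R) : (mordellCurve D).c₄ = 0 := by
  simp only [mordellCurve, c₄, b₂, b₄]; ring

/-- The affine equation of `E_D` reads `y² = x³ + D`. [folklore] -/
theorem mordellCurve_equation_iff (D x y : R) :
    (mordellCurve D).toAffine.Equation x y ↔ y ^ 2 = x ^ 3 + D := by
  rw [Affine.equation_iff]
  simp only [mordellCurve]
  constructor <;> intro e <;> linear_combination e

/-- Negation on `E_D` is `(x, y) ↦ (x, −y)`. [folklore] -/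
@[simp] theorem mordellCurve_negY (D x y : R) : (mordellCurve D).toAffine.negY x y = -y := by
  simp [Affine.negY, mordellCurve]

end Model

section FieldModel

variable {F : Type*} [Field F]

/-- `E_D` is an elliptic curve iff `432 D² ≠ 0` (over a field of characteristic `0`: iff `D ≠ 0`).
[folklore] -/
theorem isElliptic_mordellCurve [CharZero F] {D : F} (hD : D ≠ 0) : (mordellCurve D).IsElliptic := by
  rw [WeierstrassCurve.isElliptic_iff, mordellCurve_Δ, isUnit_iff_ne_zero, neg_ne_zero]
  exact mul_ne_zero (by norm_num) (pow_ne_zero 2 hD)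

/-- On an elliptic Mordell curve every solution of the equation is a nonsingular point. [folklore] -/
theorem nonsingular_mordellCurve_of_equation [CharZero F] {D : F} (hD : D ≠ 0) {x y : F}
    (h : (mordellCurve D).toAffine.Equation x y) : (mordellCurve D).toAffine.Nonsingular x y := by
  haveI := isElliptic_mordellCurve hD
  exact (WeierstrassCurve.Affine.equation_iff_nonsingular).mp h

end FieldModel

/-! ## `√−3`, `ω` and the mod-`3` cyclotomic sign on `Γ_K` -/

namespace MordellDescent

variable (K : Type u) [Field K] [CharZero K]

/-- An element of `Γ_K` as an automorphism of `K̄` (`Field.absoluteGaloisGroup K` is by definition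
`K̄ ≃ₐ[K] K̄`). [folklore] -/
def galAut {K : Type u} [Field K] (σ : Field.absoluteGaloisGroup K) :
    AlgebraicClosure K ≃ₐ[K] AlgebraicClosure K := σ

/-- `galAut` is multiplicative (definitional). [folklore] -/
theorem galAut_mul {K : Type u} [Field K] (σ τ : Field.absoluteGaloisGroup K) :
    galAut (σ * τ) = galAut σ * galAut τ := rfl

/-- `(στ) x = σ (τ x)` (definitional). [folklore] -/
theorem galAut_mul_apply {K : Type u} [Field K] (σ τ : Field.absoluteGaloisGroup K)
    (x : AlgebraicClosure K) : galAut (σ * τ) x = galAut σ (galAut τ x) := rfl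

/-- `√−3 ∈ K̄`: a chosen square root of `−3`. [folklore] -/
def theta : AlgebraicClosure K :=
  Classical.choose (IsAlgClosed.exists_eq_mul_self (-3 : AlgebraicClosure K))

omit [CharZero K] in
/-- `√−3 · √−3 = −3`. [folklore] -/
theorem theta_mul_theta : theta K * theta K = -3 :=
  (Classical.choose_spec (IsAlgClosed.exists_eq_mul_self (-3 : AlgebraicClosure K))).symm

omit [CharZero K] in
/-- `(√−3)² = −3`. [folklore] -/
theorem theta_sq : theta K ^ 2 = -3 := by rw [pow_two, theta_mul_theta]

/-- `√−3 ≠ 0`. [folklore] -/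
theorem theta_ne_zero : theta K ≠ 0 := fun h => by
  have := theta_mul_theta K
  rw [h, mul_zero] at this
  norm_num at this

/-- `√−3 ≠ −√−3` (characteristic `0`). [folklore] -/
theorem theta_ne_neg : theta K ≠ -theta K := fun h =>
  theta_ne_zero K (by have : (2 : AlgebraicClosure K) * theta K = 0 := by linear_combination h
                      simpa using this)

/-- `ω = (√−3 − 1)/2 ∈ K̄`. [folklore] -/
def omega : AlgebraicClosure K := (theta K - 1) / 2

/-- `ω² + ω + 1 = 0`. [folklore] -/
theorem omega_sq_add : omega K ^ 2 + omega K + 1 = 0 := by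
  have h := theta_mul_theta K
  simp only [omega]
  field_simp
  linear_combination h

/-- `ω³ = 1`. [folklore] -/
theorem omega_pow_three : omega K ^ 3 = 1 := by
  linear_combination (omega K - 1) * omega_sq_add K

/-- `ω ≠ 1` (characteristic `0`). [folklore] -/
theorem omega_ne_one : omega K ≠ 1 := fun h => by
  have := omega_sq_add K
  rw [h] at this
  norm_num at this

/-- `ω² = −ω − 1 = (−√−3 − 1)/2`. [folklore] -/
theorem omega_sq : omega K ^ 2 = (-theta K - 1) / 2 := by
  have h := theta_mul_theta K
  simp only [omega]
  field_simp
  linear_combination h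

/-- **`ω` is a primitive cube root of unity.** [folklore] -/
theorem isPrimitiveRoot_omega : IsPrimitiveRoot (omega K) 3 := by
  refine (IsPrimitiveRoot.iff (by norm_num)).mpr ⟨omega_pow_three K, fun l hl hl3 => ?_⟩
  interval_cases l
  · rw [pow_one]; exact omega_ne_one K
  · intro h
    have h1 : omega K = -2 := by linear_combination omega_sq_add K - h
    rw [h1] at h
    norm_num at h

/-- `ω ≠ 0`. [folklore] -/
theorem omega_ne_zero : omega K ≠ 0 :=
  (isPrimitiveRoot_omega K).ne_zero (by norm_num)

/-- The cube roots of unity of `K̄` are `1, ω, ω²`: `z³ = 1 ⇒ z = ω^i` for some `i < 3`. [folklore] -/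
theorem exists_pow_eq_of_pow_three_eq_one {z : AlgebraicClosure K} (hz : z ^ 3 = 1) :
    ∃ i < 3, omega K ^ i = z :=
  (isPrimitiveRoot_omega K).eq_pow_of_pow_eq_one hz

/-- `ω^a = ω^b ↔ a ≡ b (mod 3)`, in the form `(a : ℤ/3) = b`. [folklore] -/
theorem omega_pow_eq_pow_iff {a b : ℕ} : omega K ^ a = omega K ^ b ↔ (a : ZMod 3) = b := by
  have h3 := omega_pow_three K
  have hmod : ∀ n : ℕ, omega K ^ n = omega K ^ (n % 3) := fun n => by
    conv_lhs => rw [← Nat.div_add_mod n 3, pow_add, pow_mul, h3, one_pow, one_mul]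
  rw [hmod a, hmod b, ZMod.natCast_eq_natCast_iff]
  constructor
  · intro h
    exact (isPrimitiveRoot_omega K).pow_inj (Nat.mod_lt _ (by norm_num)) (Nat.mod_lt _ (by norm_num)) h
  · intro h
    rw [h]

variable {K}

omit [CharZero K] in
/-- `Γ_K` fixes `−3`, so it sends `√−3` to `±√−3`. [folklore] -/
theorem galAut_theta (σ : Field.absoluteGaloisGroup K) :
    galAut σ (theta K) = theta K ∨ galAut σ (theta K) = -theta K := by
  rw [← mul_self_eq_mul_self_iff, ← map_mul, theta_mul_theta, map_neg, map_ofNat]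

omit [CharZero K] in
/-- `σ ω = ω` when `σ √−3 = √−3`. [folklore] -/
theorem galAut_omega_of_fix {σ : Field.absoluteGaloisGroup K} (h : galAut σ (theta K) = theta K) :
    galAut σ (omega K) = omega K := by
  simp only [omega, map_div₀, map_sub, map_one, map_ofNat, h]

/-- `σ ω = ω²` when `σ √−3 = −√−3`. [folklore] -/
theorem galAut_omega_of_neg {σ : Field.absoluteGaloisGroup K} (h : galAut σ (theta K) = -theta K) :
    galAut σ (omega K) = omega K ^ 2 := by
  rw [omega_sq]
  simp only [omega, map_div₀, map_sub, map_one, map_ofNat, h]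

/-- **The mod-`3` cyclotomic sign** `eps σ ∈ {1, −1} ⊂ ℤ/3ℤ`: `σ ζ = ζ^{eps σ}` on cube roots of
unity (`galAut_omega_pow`). [folklore] -/
def eps (σ : Field.absoluteGaloisGroup K) : ZMod 3 :=
  if galAut σ (theta K) = theta K then 1 else -1

/-- The sign as a natural exponent: `1` or `2`. [folklore] -/
def epsNat (σ : Field.absoluteGaloisGroup K) : ℕ :=
  if galAut σ (theta K) = theta K then 1 else 2

omit [CharZero K] in
/-- `epsNat` reduces to `eps` in `ℤ/3ℤ` (`2 = −1`). [folklore] -/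
theorem epsNat_cast (σ : Field.absoluteGaloisGroup K) : ((epsNat σ : ℕ) : ZMod 3) = eps σ := by
  unfold epsNat eps
  split_ifs <;> decide

/-- `σ ω = ω^{eps σ}`. [folklore] -/
theorem galAut_omega (σ : Field.absoluteGaloisGroup K) : galAut σ (omega K) = omega K ^ epsNat σ := by
  unfold epsNat
  split_ifs with h
  · rw [pow_one]; exact galAut_omega_of_fix h
  · exact galAut_omega_of_neg ((galAut_theta σ).resolve_left h)

/-- `σ (ω^n) = ω^{eps σ · n}`. [folklore] -/
theorem galAut_omega_pow (σ : Field.absoluteGaloisGroup K) (n : ℕ) :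
    galAut σ (omega K ^ n) = omega K ^ (epsNat σ * n) := by
  rw [map_pow, galAut_omega, ← pow_mul]

/-- `eps` is a character: `eps (στ) = eps σ · eps τ`. [folklore] -/
theorem eps_mul (σ τ : Field.absoluteGaloisGroup K) : eps (σ * τ) = eps σ * eps τ := by
  have hne := theta_ne_neg K
  have h11 : (-1 : ZMod 3) * -1 = 1 := by decide
  unfold eps
  rw [galAut_mul_apply]
  rcases galAut_theta τ with ht | ht <;> rw [ht]
  · rcases galAut_theta σ with hs | hs <;> rw [hs]
    · simp
    · simp [hne.symm]
  · rw [map_neg]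
    rcases galAut_theta σ with hs | hs <;> rw [hs]
    · simp [hne.symm]
    · simp [hne.symm, h11]

/-! ## Cube roots and the additive Kummer cocycle `kummerExp a : Γ_K → ℤ/3ℤ` -/

/-- A chosen cube root `∛a ∈ K̄` of `a ∈ K`. [folklore] -/
def cubeRoot (a : K) : AlgebraicClosure K :=
  Classical.choose (IsAlgClosed.exists_pow_nat_eq (algebraMap K (AlgebraicClosure K) a) (n := 3)
    (by norm_num))

omit [CharZero K] in
/-- `(∛a)³ = a`. [folklore] -/
theorem cubeRoot_pow_three (a : K) : cubeRoot a ^ 3 = algebraMap K (AlgebraicClosure K) a :=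
  Classical.choose_spec (IsAlgClosed.exists_pow_nat_eq (algebraMap K (AlgebraicClosure K) a)
    (n := 3) (by norm_num))

omit [CharZero K] in
/-- `∛a ≠ 0` for `a ≠ 0`. [folklore] -/
theorem cubeRoot_ne_zero {a : K} (ha : a ≠ 0) : cubeRoot a ≠ 0 := fun h => by
  have := cubeRoot_pow_three a
  rw [h, zero_pow three_ne_zero, eq_comm, map_eq_zero] at this
  exact ha this

/-- `σ(∛a)/∛a` is a cube root of unity, so `σ(∛a) = ω^i ∛a` for some `i < 3`. [folklore] -/
theorem exists_galAut_cubeRoot {a : K} (ha : a ≠ 0) (σ : Field.absoluteGaloisGroup K) :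
    ∃ i < 3, galAut σ (cubeRoot a) = omega K ^ i * cubeRoot a := by
  have hα := cubeRoot_ne_zero ha
  have hz : (galAut σ (cubeRoot a) / cubeRoot a) ^ 3 = 1 := by
    rw [div_pow, ← map_pow, cubeRoot_pow_three, AlgEquiv.commutes, div_self]
    rw [← cubeRoot_pow_three]
    exact pow_ne_zero 3 hα
  obtain ⟨i, hi, h⟩ := exists_pow_eq_of_pow_three_eq_one K hz
  exact ⟨i, hi, by rw [h, div_mul_cancel₀ _ hα]⟩

/-- **The additive Kummer cocycle** `kummerExp a σ ∈ ℤ/3ℤ`: the exponent with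
`σ(∛a) = ω^{kummerExp a σ} ∛a` (`galAut_cubeRoot`). For `a = 0` it is the junk value `0`.
[folklore] -/
def kummerExp (a : K) (σ : Field.absoluteGaloisGroup K) : ZMod 3 :=
  if ha : a ≠ 0 then ((Classical.choose (exists_galAut_cubeRoot ha σ) : ℕ) : ZMod 3) else 0

/-- The defining property `σ(∛a) = ω^{kummerExp a σ} ∛a` (exponent read through `ZMod.val`).
[folklore] -/
theorem galAut_cubeRoot {a : K} (ha : a ≠ 0) (σ : Field.absoluteGaloisGroup K) :
    galAut σ (cubeRoot a) = omega K ^ (kummerExp a σ).val * cubeRoot a := by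
  obtain ⟨hi, h⟩ := Classical.choose_spec (exists_galAut_cubeRoot ha σ)
  rw [kummerExp, dif_pos ha, ZMod.val_natCast_of_lt hi]
  exact h

/-- Uniqueness of the exponent: `ω^i ∛a = ω^j ∛a ⇒ i ≡ j (mod 3)`. [folklore] -/
theorem natCast_eq_of_omega_pow_mul_cubeRoot_eq {a : K} (ha : a ≠ 0) {i j : ℕ}
    (h : omega K ^ i * cubeRoot a = omega K ^ j * cubeRoot a) : (i : ZMod 3) = j :=
  (omega_pow_eq_pow_iff K).mp (mul_right_cancel₀ (cubeRoot_ne_zero ha) h)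

/-- Characterisation of `kummerExp`: if `σ(∛a) = ω^i ∛a` then `kummerExp a σ = i`. [folklore] -/
theorem kummerExp_eq_of_galAut_eq {a : K} (ha : a ≠ 0) {σ : Field.absoluteGaloisGroup K} {i : ℕ}
    (h : galAut σ (cubeRoot a) = omega K ^ i * cubeRoot a) : kummerExp a σ = i := by
  have := natCast_eq_of_omega_pow_mul_cubeRoot_eq ha ((galAut_cubeRoot ha σ).symm.trans h)
  rwa [ZMod.natCast_zmod_val] at this

/-- **The Kummer cocycle identity** (values in `μ₃`, written additively):
`kummerExp a (στ) = kummerExp a σ + eps σ · kummerExp a τ`, since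
`στ(∛a) = σ(ω^{n_τ} ∛a) = ω^{eps σ · n_τ} ω^{n_σ} ∛a`. [folklore] -/
theorem kummerExp_mul {a : K} (ha : a ≠ 0) (σ τ : Field.absoluteGaloisGroup K) :
    kummerExp a (σ * τ) = kummerExp a σ + eps σ * kummerExp a τ := by
  have h : galAut (σ * τ) (cubeRoot a) =
      omega K ^ (epsNat σ * (kummerExp a τ).val + (kummerExp a σ).val) * cubeRoot a := by
    rw [galAut_mul_apply, galAut_cubeRoot ha τ, map_mul, galAut_omega_pow, galAut_cubeRoot ha σ,
      pow_add]
    ring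
  rw [kummerExp_eq_of_galAut_eq ha h, Nat.cast_add, Nat.cast_mul, epsNat_cast, ZMod.natCast_zmod_val,
    ZMod.natCast_zmod_val, add_comm]

/-- `kummerExp a 1 = 0`. [folklore] -/
theorem kummerExp_one {a : K} (ha : a ≠ 0) : kummerExp a 1 = 0 := by
  have h : galAut (1 : Field.absoluteGaloisGroup K) (cubeRoot a) = omega K ^ (0 : ℕ) * cubeRoot a := by
    rw [pow_zero, one_mul]; rfl
  rw [kummerExp_eq_of_galAut_eq ha h, Nat.cast_zero]

/-- `kummerExp a` is constant on the cosets of the stabiliser of `∛a`: if `τ` fixes `∛a` then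
`kummerExp a (στ) = kummerExp a σ`. [folklore] -/
theorem kummerExp_mul_of_fix {a : K} (ha : a ≠ 0) {σ τ : Field.absoluteGaloisGroup K}
    (hτ : galAut τ (cubeRoot a) = cubeRoot a) : kummerExp a (σ * τ) = kummerExp a σ := by
  have h : galAut (σ * τ) (cubeRoot a) = omega K ^ (kummerExp a σ).val * cubeRoot a := by
    rw [galAut_mul_apply, hτ, galAut_cubeRoot ha σ]
  rw [kummerExp_eq_of_galAut_eq ha h, ZMod.natCast_zmod_val]

/-- The chosen cube roots of `a`, `b`, `ab` are related by `∛(ab) = ω^j ∛a ∛b` for some `j < 3`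
(then `kummerExp (ab) σ = kummerExp a σ + kummerExp b σ + (eps σ − 1) j`, `kummerExp_mul_left`).
[folklore] -/
theorem exists_cubeRoot_mul {a b : K} (ha : a ≠ 0) (hb : b ≠ 0) :
    ∃ j < 3, cubeRoot (a * b) = omega K ^ j * (cubeRoot a * cubeRoot b) := by
  have hαβ : cubeRoot a * cubeRoot b ≠ 0 := mul_ne_zero (cubeRoot_ne_zero ha) (cubeRoot_ne_zero hb)
  have hz : (cubeRoot (a * b) / (cubeRoot a * cubeRoot b)) ^ 3 = 1 := by
    rw [div_pow, mul_pow, cubeRoot_pow_three, cubeRoot_pow_three, cubeRoot_pow_three, ← map_mul,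
      div_self]
    rw [map_ne_zero_iff _ (algebraMap K (AlgebraicClosure K)).injective]
    exact mul_ne_zero ha hb
  obtain ⟨j, hj, h⟩ := exists_pow_eq_of_pow_three_eq_one K hz
  exact ⟨j, hj, by rw [h, div_mul_cancel₀ _ hαβ]⟩

/-- **Multiplicativity in `a` up to a coboundary**: with `j` as in `exists_cubeRoot_mul`,
`kummerExp (ab) σ = kummerExp a σ + kummerExp b σ + (eps σ − 1) · j`. [folklore] -/
theorem kummerExp_mul_left {a b : K} (ha : a ≠ 0) (hb : b ≠ 0) {j : ℕ}
    (hj : cubeRoot (a * b) = omega K ^ j * (cubeRoot a * cubeRoot b)) (σ : Field.absoluteGaloisGroup K) :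
    kummerExp (a * b) σ = kummerExp a σ + kummerExp b σ + (eps σ - 1) * j := by
  have hab : a * b ≠ 0 := mul_ne_zero ha hb
  -- `σ ∛(ab) = ω^{e j} ω^{n_a} ∛a ω^{n_b} ∛b = ω^{e j + n_a + n_b - j} ∛(ab)` (exponents mod 3)
  have h : galAut σ (cubeRoot (a * b)) =
      omega K ^ (epsNat σ * j + (kummerExp a σ).val + (kummerExp b σ).val + 2 * j) * cubeRoot (a * b) := by
    have hω3 := omega_pow_three K
    rw [hj, map_mul, map_mul, galAut_omega_pow, galAut_cubeRoot ha, galAut_cubeRoot hb]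
    have : omega K ^ (epsNat σ * j + (kummerExp a σ).val + (kummerExp b σ).val + 2 * j) *
        (omega K ^ j * (cubeRoot a * cubeRoot b)) =
        omega K ^ (epsNat σ * j + (kummerExp a σ).val + (kummerExp b σ).val) *
          (omega K ^ 3) ^ j * (cubeRoot a * cubeRoot b) := by ring
    rw [this, hω3, one_pow, mul_one]
    ring
  rw [kummerExp_eq_of_galAut_eq hab h]
  push_cast
  rw [epsNat_cast, ZMod.natCast_zmod_val, ZMod.natCast_zmod_val]
  have h3 : (2 : ZMod 3) = -1 := by decide
  rw [h3]
  ring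

/-- If `a = b³` is a cube in `K` then `∛a = ω^j b` and `kummerExp a σ = (eps σ − 1) j` is a
coboundary. [folklore] -/
theorem exists_cubeRoot_eq_of_eq_cube {a b : K} (ha : a ≠ 0) (h : a = b ^ 3) :
    ∃ j < 3, cubeRoot a = omega K ^ j * algebraMap K (AlgebraicClosure K) b := by
  have hb : b ≠ 0 := by rintro rfl; exact ha (by rw [h]; ring)
  have hb' : algebraMap K (AlgebraicClosure K) b ≠ 0 :=
    (map_ne_zero_iff _ (algebraMap K (AlgebraicClosure K)).injective).mpr hb
  have hz : (cubeRoot a / algebraMap K (AlgebraicClosure K) b) ^ 3 = 1 := by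
    rw [div_pow, cubeRoot_pow_three, ← map_pow, ← h, div_self]
    exact (map_ne_zero_iff _ (algebraMap K (AlgebraicClosure K)).injective).mpr ha
  obtain ⟨j, hj, e⟩ := exists_pow_eq_of_pow_three_eq_one K hz
  exact ⟨j, hj, by rw [e, div_mul_cancel₀ _ hb']⟩

/-- For a cube `a = b³` with `∛a = ω^j b`: `kummerExp a σ = (eps σ − 1) j`. [folklore] -/
theorem kummerExp_of_eq_cube {a b : K} (ha : a ≠ 0) {j : ℕ}
    (hj : cubeRoot a = omega K ^ j * algebraMap K (AlgebraicClosure K) b)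
    (σ : Field.absoluteGaloisGroup K) : kummerExp a σ = (eps σ - 1) * j := by
  have h : galAut σ (cubeRoot a) = omega K ^ (epsNat σ * j + 2 * j) * cubeRoot a := by
    have hω3 := omega_pow_three K
    conv_lhs => rw [hj, map_mul, galAut_omega_pow, AlgEquiv.commutes]
    rw [hj]
    have : omega K ^ (epsNat σ * j + 2 * j) * (omega K ^ j * algebraMap K (AlgebraicClosure K) b) =
        omega K ^ (epsNat σ * j) * (omega K ^ 3) ^ j * algebraMap K (AlgebraicClosure K) b := by ring
    rw [this, hω3, one_pow, mul_one]
  rw [kummerExp_eq_of_galAut_eq ha h]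
  push_cast
  rw [epsNat_cast]
  have h3 : (2 : ZMod 3) = -1 := by decide
  rw [h3]
  ring

/-! ## Galois action on geometric points with explicit coordinates -/

omit [CharZero K] in
/-- The stabiliser-type sets `{σ | σ x = y}` are open in `Γ_K` (they are empty or cosets of the open
subgroup `Gal(K̄/K(x))`). [folklore] -/
theorem isOpen_setOf_galAut_eq (x y : AlgebraicClosure K) :
    IsOpen {σ : Field.absoluteGaloisGroup K | galAut σ x = y} := by
  let E : IntermediateField K (AlgebraicClosure K) := IntermediateField.adjoin K {x}
  haveI : FiniteDimensional K E := IntermediateField.finiteDimensional_adjoin fun z _ =>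
    Algebra.IsIntegral.isIntegral z
  let H : Subgroup (Field.absoluteGaloisGroup K) := E.fixingSubgroup
  have hHopen : IsOpen (H : Set (Field.absoluteGaloisGroup K)) := E.fixingSubgroup_isOpen
  have hfix : ∀ τ ∈ (H : Set (Field.absoluteGaloisGroup K)), galAut τ x = x := by
    intro τ hτ
    have hτ' : galAut τ ∈ E.fixingSubgroup := hτ
    rw [IntermediateField.mem_fixingSubgroup_iff] at hτ'
    exact hτ' _ (IntermediateField.subset_adjoin K _ (Set.mem_singleton x))
  rw [isOpen_iff_mem_nhds]
  intro σ hσ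
  have hopen : IsOpen ((fun τ => σ * τ) '' (H : Set (Field.absoluteGaloisGroup K))) :=
    (isOpenMap_mul_left σ) _ hHopen
  refine Filter.mem_of_superset (hopen.mem_nhds ⟨1, H.one_mem, mul_one σ⟩) ?_
  rintro _ ⟨τ, hτ, rfl⟩
  simp only [Set.mem_setOf_eq] at hσ ⊢
  rw [galAut_mul_apply, hfix τ hτ, hσ]

omit [CharZero K] in
/-- Nonsingularity is preserved by the Galois action on coordinates. [folklore] -/
theorem nonsingular_galAut {W : WeierstrassCurve K} (σ : Field.absoluteGaloisGroup K)
    {x y : AlgebraicClosure K} (h : (W.baseChange (AlgebraicClosure K)).toAffine.Nonsingular x y) :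
    (W.baseChange (AlgebraicClosure K)).toAffine.Nonsingular (galAut σ x) (galAut σ y) :=
  (W.toAffine.baseChange_nonsingular
    ((galAut σ : AlgebraicClosure K ≃ₐ[K] AlgebraicClosure K) :
      AlgebraicClosure K →ₐ[K] AlgebraicClosure K).injective ..).mpr h

omit [CharZero K] in
/-- The Galois action on an affine geometric point acts on its coordinates. [folklore] -/
theorem smul_geomPoints_some {W : WeierstrassCurve K} (σ : Field.absoluteGaloisGroup K)
    {x y : AlgebraicClosure K} (h : (W.baseChange (AlgebraicClosure K)).toAffine.Nonsingular x y)
    (h' : (W.baseChange (AlgebraicClosure K)).toAffine.Nonsingular (galAut σ x) (galAut σ y)) :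
    σ • (show geomPoints W from Affine.Point.some x y h) = Affine.Point.some (galAut σ x) (galAut σ y) h' := by
  change Affine.Point.map ((galAut σ : AlgebraicClosure K ≃ₐ[K] AlgebraicClosure K) :
      AlgebraicClosure K →ₐ[K] AlgebraicClosure K) (Affine.Point.some x y h) = _
  rw [Affine.Point.map_some]
  rfl

omit [CharZero K] in
/-- Affine points with equal coordinates are equal (proof-irrelevance helper). [folklore] -/
theorem point_some_ext {F' : Type*} [Field F'] {W' : WeierstrassCurve F'} {x y x' y' : F'}
    {h : W'.toAffine.Nonsingular x y} {h' : W'.toAffine.Nonsingular x' y'} (hx : x = x') (hy : y = y') :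
    (Affine.Point.some x y h : W'.toAffine.Point) = Affine.Point.some x' y' h' := by
  subst hx; subst hy; rfl

/-! ## The kernel point `T = (0, c√−3)` of the `3`-isogeny `φ` on `E_D`, `D = −3c²` -/

variable {D c : K}

/-- `s = c √−3 ∈ K̄`, the `y`-coordinate of `T`. [folklore] -/
def sCoord (c : K) : AlgebraicClosure K := algebraMap K (AlgebraicClosure K) c * theta K

omit [CharZero K] in
/-- `s² = −3c² = D`. [folklore] -/
theorem sCoord_sq (c : K) : sCoord c ^ 2 = algebraMap K (AlgebraicClosure K) (-3 * c ^ 2) := by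
  rw [sCoord, mul_pow, theta_sq, map_mul, map_pow, map_neg, map_ofNat]; ring

omit [CharZero K] in
/-- `Γ_K` sends `s` to `±s` as it sends `√−3` to `±√−3`. [folklore] -/
theorem galAut_sCoord_of_fix {σ : Field.absoluteGaloisGroup K} (h : galAut σ (theta K) = theta K) :
    galAut σ (sCoord c) = sCoord c := by
  rw [sCoord, map_mul, AlgEquiv.commutes, h]

omit [CharZero K] in
/-- `σ s = −s` when `σ √−3 = −√−3`. [folklore] -/
theorem galAut_sCoord_of_neg {σ : Field.absoluteGaloisGroup K} (h : galAut σ (theta K) = -theta K) :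
    galAut σ (sCoord c) = -sCoord c := by
  rw [sCoord, map_mul, AlgEquiv.commutes, h, mul_neg]

/-- **`(E_D, E_{81c²})` over `K̄` is the Vélu three-pair with parameters `(m, s) = (0, c√−3)`**:
`E_D = [0,0,0,0,s²]` (`s² = −3c² = D`) and `E_{81c²} = [0,0,0,0,−27s²]`; so the tree's
`3`-isogeny `φ` of file `ThreeIsogeny` with kernel `{O, (0, ±s)}` is available on `E_D(K̄)`.
[folklore] -/
theorem isVeluThreePair_mordell (hc : c ≠ 0) (hD : D = -3 * c ^ 2) :
    IsVeluThreePair (0 : AlgebraicClosure K) (sCoord c)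
      ((mordellCurve D).baseChange (AlgebraicClosure K))
      ((mordellCurve (81 * c ^ 2)).baseChange (AlgebraicClosure K)) where
  a₁_eq := by rw [mordellCurve_baseChange]; rfl
  a₂_eq := by rw [mordellCurve_baseChange, mordellCurve_a₂]; ring
  a₃_eq := by rw [mordellCurve_baseChange]; rfl
  a₄_eq := by rw [mordellCurve_baseChange, mordellCurve_a₄]; ring
  a₆_eq := by rw [mordellCurve_baseChange, mordellCurve_a₆, hD, sCoord_sq]
  a₁'_eq := by rw [mordellCurve_baseChange]; rfl
  a₂'_eq := by rw [mordellCurve_baseChange, mordellCurve_a₂]; ring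
  a₃'_eq := by rw [mordellCurve_baseChange]; rfl
  a₄'_eq := by rw [mordellCurve_baseChange, mordellCurve_a₄]; ring
  a₆'_eq := by
    rw [mordellCurve_baseChange, mordellCurve_a₆, sCoord_sq, map_mul, map_mul, map_pow, map_neg,
      map_ofNat, map_ofNat]
    ring
  Δ_ne := by
    rw [mordellCurve_baseChange, mordellCurve_Δ, neg_ne_zero]
    refine mul_ne_zero (by norm_num) (pow_ne_zero 2 ?_)
    rw [map_ne_zero_iff _ (algebraMap K (AlgebraicClosure K)).injective, hD]
    exact mul_ne_zero (by norm_num) (pow_ne_zero 2 hc)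

/-- **The kernel point `T = (0, c√−3) ∈ E_D(K̄)`** of `φ : E_D → E_{81c²}`
(`E_D[φ] = {O, T, −T}`). [folklore] -/
def torsT (hc : c ≠ 0) (hD : D = -3 * c ^ 2) : geomPoints (mordellCurve D) :=
  (isVeluThreePair_mordell hc hD).T

/-- `T = (0, c√−3)` in coordinates. [folklore] -/
theorem torsT_eq (hc : c ≠ 0) (hD : D = -3 * c ^ 2) :
    torsT hc hD = Affine.Point.some 0 (sCoord c) (isVeluThreePair_mordell hc hD).nonsingular_T :=
  rfl

/-- `T ≠ O`. [folklore] -/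
theorem torsT_ne_zero (hc : c ≠ 0) (hD : D = -3 * c ^ 2) : torsT hc hD ≠ 0 :=
  (isVeluThreePair_mordell hc hD).T_ne_zero

/-- `T + T = −T`: `T` has order `3`. [folklore] -/
theorem torsT_add_torsT (hc : c ≠ 0) (hD : D = -3 * c ^ 2) :
    torsT hc hD + torsT hc hD = -torsT hc hD :=
  (isVeluThreePair_mordell hc hD).T_add_T

/-- `3T = O`. [folklore] -/
theorem three_nsmul_torsT (hc : c ≠ 0) (hD : D = -3 * c ^ 2) : (3 : ℕ) • torsT hc hD = 0 := by
  rw [succ_nsmul, two_nsmul, torsT_add_torsT, neg_add_cancel]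

/-- **`E_D[φ] ≅ μ₃` as a Galois module**: `σ T = T` if `σ √−3 = √−3` and `σ T = −T` otherwise
(`T = (0, c√−3)`). [folklore] -/
theorem smul_torsT (hc : c ≠ 0) (hD : D = -3 * c ^ 2) (σ : Field.absoluteGaloisGroup K) :
    σ • torsT hc hD = if galAut σ (theta K) = theta K then torsT hc hD else -torsT hc hD := by
  have hV := isVeluThreePair_mordell hc hD
  rw [torsT_eq, smul_geomPoints_some σ _ (nonsingular_galAut σ hV.nonsingular_T)]
  split_ifs with h
  · exact point_some_ext (map_zero _) (galAut_sCoord_of_fix h)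
  · have e : -torsT hc hD = Affine.Point.some 0 (-sCoord c) hV.nonsingular_negT := hV.neg_T
    exact (point_some_ext (map_zero _) (galAut_sCoord_of_neg ((galAut_theta σ).resolve_left h))).trans
      e.symm

/-- The additive map `ℤ/3ℤ → E_D(K̄)`, `n ↦ n T` (well defined as `3T = O`). [folklore] -/
def chiT (hc : c ≠ 0) (hD : D = -3 * c ^ 2) : ZMod 3 →+ geomPoints (mordellCurve D) :=
  ZMod.lift 3 ⟨zmultiplesHom (geomPoints (mordellCurve D)) (torsT hc hD), by
    change ((3 : ℕ) : ℤ) • torsT hc hD = 0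
    rw [natCast_zsmul, three_nsmul_torsT]⟩

/-- `chiT z = z T` for `z ∈ ℤ`. [folklore] -/
theorem chiT_intCast (hc : c ≠ 0) (hD : D = -3 * c ^ 2) (z : ℤ) :
    chiT hc hD (z : ZMod 3) = z • torsT hc hD :=
  ZMod.lift_coe 3 _ z

/-- `chiT 1 = T`. [folklore] -/
theorem chiT_one (hc : c ≠ 0) (hD : D = -3 * c ^ 2) : chiT hc hD 1 = torsT hc hD := by
  rw [← Int.cast_one, chiT_intCast, one_zsmul]

/-- **Galois equivariance of `n ↦ nT`**: `σ (n T) = (eps σ · n) T`. [folklore] -/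
theorem smul_chiT (hc : c ≠ 0) (hD : D = -3 * c ^ 2) (σ : Field.absoluteGaloisGroup K) (k : ZMod 3) :
    σ • chiT hc hD k = chiT hc hD (eps σ * k) := by
  have hz : ∀ z : ℤ, σ • (z • torsT hc hD) = z • (σ • torsT hc hD) := fun z =>
    map_zsmul (DistribSMul.toAddMonoidHom (geomPoints (mordellCurve D)) σ) z (torsT hc hD)
  rw [← ZMod.intCast_zmod_cast k, chiT_intCast, hz, smul_torsT, eps]
  split_ifs
  · rw [one_mul, chiT_intCast]
  · rw [neg_one_mul, ← Int.cast_neg, chiT_intCast, neg_zsmul, zsmul_neg]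

/-! ## The torsor cocycles `σ ↦ kummerExp a σ · T` and their classes in `H¹(K, E_D)` -/

/-- The values `σ ↦ (kummerExp a σ) T` of the cocycle attached to `a ∈ K*`. [folklore] -/
def torsorFun (hc : c ≠ 0) (hD : D = -3 * c ^ 2) (a : K) (σ : Field.absoluteGaloisGroup K) :
    geomPoints (mordellCurve D) :=
  chiT hc hD (kummerExp a σ)

/-- **The crossed-homomorphism identity** `f(στ) = f(σ) + σ f(τ)`: the Kummer cocycle identity
`n(στ) = n(σ) + eps(σ) n(τ)` together with `σ T = eps(σ) T` — i.e. `E_D[φ] ≅ μ₃`.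
[cite: Cassels1964ArithmeticVI, p. 65 (the map `ℚ* → WC`)] -/
theorem torsorFun_mul (hc : c ≠ 0) (hD : D = -3 * c ^ 2) {a : K} (ha : a ≠ 0)
    (σ τ : Field.absoluteGaloisGroup K) :
    torsorFun hc hD a (σ * τ) = torsorFun hc hD a σ + σ • torsorFun hc hD a τ := by
  simp only [torsorFun]
  rw [kummerExp_mul ha, map_add, smul_chiT]

/-- The cocycle is locally constant, hence continuous. [folklore] -/
theorem continuous_torsorFun (hc : c ≠ 0) (hD : D = -3 * c ^ 2) {a : K} (ha : a ≠ 0) :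
    Continuous (torsorFun hc hD a) := by
  apply IsLocallyConstant.continuous
  rw [IsLocallyConstant.iff_exists_open]
  intro σ
  refine ⟨{σ' | galAut σ' (cubeRoot a) = galAut σ (cubeRoot a)}, isOpen_setOf_galAut_eq _ _, rfl,
    fun σ' hσ' => ?_⟩
  simp only [torsorFun]
  rw [kummerExp_eq_of_galAut_eq ha (hσ'.trans (galAut_cubeRoot ha σ)), ZMod.natCast_zmod_val]

/-- **The torsor cocycle** of `a ∈ K*`: the continuous crossed homomorphism
`σ ↦ (kummerExp a σ) T : Γ_K → E_D(K̄)`, image of the Kummer cocycle of `∛a` under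
`μ₃ ≅ E_D[φ] ⊂ E_D(K̄)`. [cite: Cassels1964ArithmeticVI, p. 65] -/
def torsorCocycle (hc : c ≠ 0) (hD : D = -3 * c ^ 2) {a : K} (ha : a ≠ 0) :
    GaloisRepresentations.contOneCocycles
      (discreteTopRep (Field.absoluteGaloisGroup K) (geomPoints (mordellCurve D))) :=
  ⟨⟨torsorFun hc hD a, continuous_torsorFun hc hD ha⟩, fun σ τ => by
    change torsorFun hc hD a (σ * τ) = torsorFun hc hD a σ + σ • torsorFun hc hD a τ
    exact torsorFun_mul hc hD ha σ τ⟩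

/-- Values of the torsor cocycle. [folklore] -/
@[simp]
theorem torsorCocycle_apply (hc : c ≠ 0) (hD : D = -3 * c ^ 2) {a : K} (ha : a ≠ 0)
    (σ : Field.absoluteGaloisGroup K) : (torsorCocycle hc hD ha).1 σ = torsorFun hc hD a σ :=
  rfl

/-- **The class in `H¹(K, E_D)` of the torsor attached to `a ∈ K*`** — for `D = −432d²`,
`a = m`, the class of Cassels' curve (2) `m x³ + m⁻¹ y³ + d z³ = 0`: the image of `a` under
`K*/K*³ = H¹(K, μ₃) = H¹(K, E_D[φ]) → H¹(K, E_D)`. [cite: Cassels1964ArithmeticVI, p. 65] -/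
def torsorClass (hc : c ≠ 0) (hD : D = -3 * c ^ 2) {a : K} (ha : a ≠ 0) : (mordellCurve D).galH1 :=
  GaloisRepresentations.oneCocycleClass _ (torsorCocycle hc hD ha)

/-- The class only depends on `a`. [folklore] -/
theorem torsorClass_congr (hc : c ≠ 0) (hD : D = -3 * c ^ 2) {a b : K} (ha : a ≠ 0) (hb : b ≠ 0)
    (h : a = b) : torsorClass hc hD ha = torsorClass hc hD hb := by
  subst h; rfl

/-- **`3 · [C_a] = 0`**: the cocycle takes values in `E_D[φ] ⊆ E_D[3]`.
[cite: Cassels1964ArithmeticVI, p. 65] -/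
theorem three_nsmul_torsorClass (hc : c ≠ 0) (hD : D = -3 * c ^ 2) {a : K} (ha : a ≠ 0) :
    3 • torsorClass hc hD ha = 0 := by
  refine nsmul_oneCocycleClass_eq_zero _ 3 fun σ => ?_
  rw [torsorCocycle_apply, torsorFun, ← map_nsmul, nsmul_eq_mul, Nat.cast_ofNat,
    show (3 : ZMod 3) = 0 from rfl, zero_mul, map_zero]

/-- A cocycle of the shape `σ ↦ ((eps σ − 1) j) T` is the coboundary of `j T`. [folklore] -/
theorem chiT_eps_sub_one_mul (hc : c ≠ 0) (hD : D = -3 * c ^ 2) (σ : Field.absoluteGaloisGroup K)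
    (j : ZMod 3) : chiT hc hD ((eps σ - 1) * j) = σ • chiT hc hD j - chiT hc hD j := by
  rw [sub_mul, one_mul, map_sub, smul_chiT]

/-- **The class vanishes on cubes**: if `a = b³` then `[C_a] = 0` (`∛a = ω^j b`, and the cocycle
is the coboundary of `jT`). [cite: Cassels1964ArithmeticVI, p. 65] -/
theorem torsorClass_of_eq_cube (hc : c ≠ 0) (hD : D = -3 * c ^ 2) {a : K} (ha : a ≠ 0) (b : K)
    (h : a = b ^ 3) : torsorClass hc hD ha = 0 := by
  obtain ⟨j, -, hj⟩ := exists_cubeRoot_eq_of_eq_cube ha h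
  unfold torsorClass
  rw [GaloisRepresentations.oneCocycleClass_eq_zero_iff]
  refine ⟨chiT hc hD j, fun σ => ?_⟩
  change torsorFun hc hD a σ = σ • chiT hc hD j - chiT hc hD j
  rw [torsorFun, kummerExp_of_eq_cube ha hj, chiT_eps_sub_one_mul]

/-- **Multiplicativity**: `[C_{ab}] = [C_a] + [C_b]` in `H¹(K, E_D)` — the cocycles differ by the
coboundary of `jT`, `∛(ab) = ω^j ∛a ∛b` (`H¹(K, μ₃) = K*/K*³` is a homomorphic image of `K*`).
[cite: Cassels1964ArithmeticVI, p. 65] -/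
theorem torsorClass_mul (hc : c ≠ 0) (hD : D = -3 * c ^ 2) {a b : K} (ha : a ≠ 0) (hb : b ≠ 0) :
    torsorClass hc hD (mul_ne_zero ha hb) = torsorClass hc hD ha + torsorClass hc hD hb := by
  obtain ⟨j, -, hj⟩ := exists_cubeRoot_mul ha hb
  unfold torsorClass
  rw [← sub_eq_zero, ← GaloisRepresentations.oneCocycleClass_add,
    ← GaloisRepresentations.oneCocycleClass_sub, GaloisRepresentations.oneCocycleClass_eq_zero_iff]
  refine ⟨chiT hc hD j, fun σ => ?_⟩
  change torsorFun hc hD (a * b) σ - (torsorFun hc hD a σ + torsorFun hc hD b σ) =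
    σ • chiT hc hD j - chiT hc hD j
  simp only [torsorFun]
  rw [kummerExp_mul_left ha hb hj, map_add, map_add, chiT_eps_sub_one_mul]
  abel

/-- `[C_a]` for `a ∈ Kˣ`, as a monoid homomorphism `Kˣ → H¹(K, E_D)` (written multiplicatively).
[cite: Cassels1964ArithmeticVI, p. 65] -/
def torsorClassHom (hc : c ≠ 0) (hD : D = -3 * c ^ 2) : Kˣ →* Multiplicative (mordellCurve D).galH1 where
  toFun u := Multiplicative.ofAdd (torsorClass hc hD u.ne_zero)
  map_one' := by
    rw [torsorClass_of_eq_cube hc hD (1 : Kˣ).ne_zero 1 (by simp)]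
    rfl
  map_mul' u v := by
    rw [← ofAdd_add, ← torsorClass_mul]

/-- Values of `torsorClassHom`. [folklore] -/
theorem torsorClassHom_apply (hc : c ≠ 0) (hD : D = -3 * c ^ 2) (u : Kˣ) :
    torsorClassHom hc hD u = Multiplicative.ofAdd (torsorClass hc hD u.ne_zero) :=
  rfl

/-- **The map kills cubes**: `Kˣ³ ≤ ker`, so `[C_·]` factors through `Kˣ/Kˣ³ = H¹(K, μ₃)`.
[cite: Cassels1964ArithmeticVI, p. 65] -/
theorem range_powMonoidHom_three_le_ker (hc : c ≠ 0) (hD : D = -3 * c ^ 2) :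
    (powMonoidHom 3 : Kˣ →* Kˣ).range ≤ (torsorClassHom hc hD).ker := by
  rintro _ ⟨u, rfl⟩
  rw [MonoidHom.mem_ker, torsorClassHom_apply,
    torsorClass_of_eq_cube hc hD _ (u : K) (by rw [powMonoidHom_apply]; push_cast; ring)]
  rfl

/-- **`Kˣ/Kˣ³ → H¹(K, E_D)[3]`**, `[a] ↦ [C_a]`: the map `H¹(K, E_D[φ]) → H¹(K, E_D)` of the
`φ`-descent (Cassels' "mapping of the multiplicative group `ℚ*` … into the group `WC`", which
"maps `m` into an element of `Ш` iff there is everywhere locally a point on (2)").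
[cite: Cassels1964ArithmeticVI, p. 65] -/
def torsorClassQuotHom (hc : c ≠ 0) (hD : D = -3 * c ^ 2) :
    Kˣ ⧸ (powMonoidHom 3 : Kˣ →* Kˣ).range →* Multiplicative (mordellCurve D).galH1 :=
  QuotientGroup.lift _ (torsorClassHom hc hD) (range_powMonoidHom_three_le_ker hc hD)

/-- Values of `torsorClassQuotHom` on classes of units. [folklore] -/
theorem torsorClassQuotHom_mk (hc : c ≠ 0) (hD : D = -3 * c ^ 2) (u : Kˣ) :
    torsorClassQuotHom hc hD (QuotientGroup.mk u) = Multiplicative.ofAdd (torsorClass hc hD u.ne_zero) :=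
  rfl

end MordellDescent

end Literature.NumberTheory.EllipticCurves

end
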